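import Literature.AlgebraicGeometry.Resolution.ColonSecantPStandard
import Literature.AlgebraicGeometry.Resolution.SecantColonAnnihilatorTransfer
import Literature.AlgebraicGeometry.Resolution.SecantColonAnnihilatorCMClause
import Literature.AlgebraicGeometry.Resolution.SecantColonAnnihilatorExistence
import Literature.AlgebraicGeometry.Resolution.ExtAnnihilatorCharts
import Literature.AlgebraicGeometry.Resolution.CohenMacaulaySystemsOfParameters
import Mathlib.RingTheory.Regular.RegularSequence
import HarnessLib

/-!
# Kawasaki's local analysis at a closed point (Kawasaki 2000, §5, p. 2539, items 1–4)

Topic: `Literature/AlgebraicGeometry/Resolution`. The globalization step of Kawasaki's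
Macaulayfication (Kawasaki 2000, Thm. 5.1, local analysis after La. 5.3) reads, at a closed point
`p` of the projective variety `X`, with `𝒪 = 𝒪_{X,p}` a quotient of the regular local ring
`S = 𝒪_{ℙⁿ,p}` and `z_t, …, z_d` the chosen forms vanishing at `p`:

1. `z_t, …, z_d` is a `p`-standard system of parameters (type `d - 1`) of `𝒪`;
2. `𝒪/(z_t, …, z_d)` is Cohen–Macaulay when `t > 1` (the unit `z_{t-1}` lies in its annihilator
   ideal);
3. `𝒪` itself is Cohen–Macaulay off `V(z_d)`.

This file proves these three local statements from hypotheses phrased with the tree's colon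
annihilator `𝔯_S(·)` (`secantColonAnnihilator`, the Ext/colon form of Kawasaki's `𝔞(·)`), in the
exact shape consumed by the blow-up theorem `IsBlowup.cmClause_stalk_of_kawasakiCenter`
(`KawasakiBlowupStalks.lean`):

* `isPStandard_reverse_map_of_mem_secantColonAnnihilator` — item 1: if `rs = [r₁,…,r_m] ⊆ 𝔪_S`
  satisfy `rᵢ ∈ 𝔯_S(𝒪/(r₁,…,rᵢ₋₁)𝒪)` and drop `dim 𝒪` by `m`, then the images, reversed, form a
  `p`-standard sequence of `𝒪` (through `IsColonSecantSequence`, its transfer along `S ↠ 𝒪` and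
  `isPStandard_reverse`);
* `exists_regular_sop_of_unit_mem_secantColonAnnihilator` — items 2/4: if moreover a unit of `𝒪`
  lifts to `𝔯_S(𝒪/(r)𝒪)`, then `𝒪/(r)` is Cohen–Macaulay and there is `Z ⊆ 𝔪_𝒪`, weakly regular
  on `𝒪/(r)`, with `(r), Z` secant of total length `dim 𝒪`;
* `cmClause_of_unit_mem_secantColonAnnihilator` — item 3 (`m = 0`).
* `mem_secantColonAnnihilator_of_mem_map_prod_annihilator` — the bridge from a GLOBAL membership
  `z ∈ ∏ Ann_B Ext^q_B(M, B) · S` (an affine chart `B → S = B_𝔮`) to `z ∈ 𝔯_S(M_𝔮)` (base change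
  `map_prod_annihilator_EMod_baseChange_le` and THEOREM A
  `prod_annihilator_EMod_le_secantColonAnnihilator`).

Everything is proved; no named facts.

## References

* T. Kawasaki, *On Macaulayfication of Noetherian schemes*, Trans. AMS 352 (2000) 2517–2552:
  §5, proof of Thm. 5.1 (p. 2539, items 1–4), La. 5.3, Cor. 4.2. [Kawasaki2000]
-/

noncomputable section

open IsLocalRing Ideal RingTheory.Sequence Module

universe u

namespace Literature.AlgebraicGeometry.Resolution

section Local

variable {S O : Type u} [CommRing S] [IsLocalRing S] [CommRing O] [IsLocalRing O]
  [IsNoetherianRing O] [Algebra S O]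

omit [IsLocalRing O] [IsNoetherianRing O] in
/-- `(xs)𝒪 = (xs) · 𝒪` as a submodule: the quotient module `𝒪/(xs)𝒪` is the quotient ring.
[folklore] -/
theorem ofList_smul_top_eq (xs : List O) : (ofList xs • ⊤ : Submodule O O) = (ofList xs : Ideal O) := by
  rw [Ideal.smul_eq_mul, Ideal.mul_top]

omit [IsLocalRing O] [IsNoetherianRing O] in
/-- `dim Supp_𝒪(𝒪/(xs)𝒪) = dim 𝒪/(xs)`. [folklore] -/
theorem supportDim_quotient_ofList_smul_top (xs : List O) :
    supportDim O (O ⧸ (ofList xs • ⊤ : Submodule O O)) = ringKrullDim (O ⧸ (ofList xs : Ideal O)) := by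
  rw [Module.supportDim_eq_of_equiv (Submodule.quotEquivOfEq _ _ (ofList_smul_top_eq xs)),
    supportDim_quotient_eq_ringKrullDim]

/-- **Total dimension drop gives a secant sequence of the local ring**: if `xs ⊆ 𝔪` and
`dim 𝒪/(xs) + |xs| = dim 𝒪` then `xs` is secant for `𝒪`. [cite: Cesnavicius2021, §3.2] -/
theorem isSecantSequence_self_of_ringKrullDim {xs : List O} (hmem : ∀ x ∈ xs, x ∈ maximalIdeal O)
    {d e : ℕ} (hd : ringKrullDim O = d) (he : ringKrullDim (O ⧸ (ofList xs : Ideal O)) = e)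
    (hlen : e + xs.length = d) : IsSecantSequence O xs := by
  refine isSecantSequence_of_supportDim_quotient_add_length_eq hmem ?_
  rw [supportDim_quotient_ofList_smul_top, he, supportDim_self_eq_ringKrullDim, hd]
  exact_mod_cast hlen

variable (hφ : Function.Surjective (algebraMap S O))
include hφ

/-- **Item 1 of Kawasaki's local analysis.** Let `S ↠ 𝒪` be a surjection of local rings and
`rs = [r₁, …, r_m] ⊆ 𝔪_S` with `rᵢ ∈ 𝔯_S(𝒪/(r₁,…,rᵢ₋₁)𝒪)` for all `i`, whose images drop the
dimension of `𝒪` by `m`. Then the images `r̄_m, …, r̄₁` (reversed) form a `p`-standard sequence of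
`𝒪` (Kawasaki 2000, p. 2539, item 1: "`z_t, …, z_d` is a p-standard system of parameters of type
`d-1`", there deduced from `zᵢ ∈ 𝔞(𝒪/(z_{i+1},…,z_d))` via La. 2.5).
[cite: Kawasaki2000, §5 p. 2539 item 1; Def. 2.6] -/
theorem isPStandard_reverse_map_of_mem_secantColonAnnihilator {rs : List S}
    (hmem : ∀ r ∈ rs, r ∈ maximalIdeal S)
    (hann : ∀ (i : ℕ) (hi : i < rs.length),
      rs[i] ∈ secantColonAnnihilator S (O ⧸ (ofList (rs.take i) • ⊤ : Submodule S O)))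
    {d e : ℕ} (hd : ringKrullDim O = d)
    (he : ringKrullDim (O ⧸ (ofList (rs.map (algebraMap S O)) : Ideal O)) = e)
    (hlen : e + rs.length = d) :
    IsPStandard O (rs.map (algebraMap S O)).reverse := by
  haveI : Module.Finite O O := inferInstance
  have hmemO : ∀ x ∈ rs.map (algebraMap S O), x ∈ maximalIdeal O := by
    intro x hx
    obtain ⟨r, hr, rfl⟩ := List.mem_map.mp hx
    exact (mem_maximalIdeal_iff_of_surjective hφ r).mpr (hmem r hr)
  have hsecO : IsSecantSequence O (rs.map (algebraMap S O)) :=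
    isSecantSequence_self_of_ringKrullDim hmemO hd he (by rw [List.length_map]; exact hlen)
  have hsecS : IsSecantSequence (R := S) O rs := (isSecantSequence_map_iff hφ rs).mp hsecO
  have hcs : IsColonSecantSequence (S := S) O rs := ⟨hsecS, hmem, hann⟩
  exact (hcs.map_of_surjective hφ).isPStandard_reverse

/-- **Items 2–4: the unit trick and the regular system of parameters.** If in the situation of
item 1 an element `u ∈ S` whose image in `𝒪` is a unit lies in `𝔯_S(𝒪/(rs)𝒪)`, then
`𝔯_S(𝒪/(rs)𝒪) = S`, so `𝒪/(r̄s)` is Cohen–Macaulay, and any system of parameters of it lifts to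
`Z ⊆ 𝔪_𝒪` which is weakly `𝒪/(r̄s)`-regular with `r̄s, Z` secant for `𝒪` and
`|r̄s| + |Z| = dim 𝒪` (Kawasaki 2000, p. 2539, items 2–4: "`z_{t-1} ∈ 𝔞(𝒪/(z_t,…,z_d))`, that is,
`𝒪/(z_t,…,z_d)` is Cohen–Macaulay. Hence `Proj R(∏(z_i,…,z_d)𝒪) = Proj R(∏_{i ≥ t}…)` is
Cohen–Macaulay by Cor. 4.2"). [cite: Kawasaki2000, §5 p. 2539 items 2–4] -/
theorem exists_regular_sop_of_unit_mem_secantColonAnnihilator (xs : List O)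
    (hmemO : ∀ x ∈ xs, x ∈ maximalIdeal O) {u : S} (hu : IsUnit (algebraMap S O u))
    (huann : u ∈ secantColonAnnihilator S (O ⧸ (ofList xs : Ideal O)))
    {d e : ℕ} (hd : ringKrullDim O = d) (he : ringKrullDim (O ⧸ (ofList xs : Ideal O)) = e)
    (hlen : e + xs.length = d) :
    ∃ Z : List O, (∀ z ∈ Z, z ∈ maximalIdeal O) ∧
      IsWeaklyRegular (O ⧸ (ofList xs : Ideal O)) Z ∧ IsSecantSequence O (xs ++ Z) ∧
        Z.length = e := by
  -- `𝔯_S(𝒪/(xs)) = ⊤`: it contains the unit `u`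
  have huS : IsUnit u := by
    by_contra h
    have hm : u ∈ maximalIdeal S := (mem_maximalIdeal u).mpr (mem_nonunits_iff.mpr h)
    have hm' := (mem_maximalIdeal_iff_of_surjective hφ u).mpr hm
    exact (mem_maximalIdeal _).mp hm' hu
  have htop : secantColonAnnihilator S (O ⧸ (ofList xs : Ideal O)) = ⊤ :=
    Ideal.eq_top_of_isUnit_mem _ huann huS
  -- the Cohen–Macaulay clause of the local ring `𝒪/(xs)` along `S ↠ 𝒪 ↠ 𝒪/(xs)`
  have hφ' : Function.Surjective (algebraMap S (O ⧸ (ofList xs : Ideal O))) := by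
    intro y
    obtain ⟨x, rfl⟩ := Ideal.Quotient.mk_surjective y
    obtain ⟨r, rfl⟩ := hφ x
    exact ⟨r, rfl⟩
  have hne : (ofList xs : Ideal O) ≠ ⊤ := fun h => by
    have : (ofList xs : Ideal O) ≤ maximalIdeal O := Ideal.span_le.mpr fun x hx => hmemO x hx
    exact (maximalIdeal.isMaximal O).ne_top (top_le_iff.mp (h ▸ this))
  haveI : Nontrivial (O ⧸ (ofList xs : Ideal O)) := Ideal.Quotient.nontrivial_iff.mpr hne
  haveI : IsLocalRing (O ⧸ (ofList xs : Ideal O)) :=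
    IsLocalRing.of_surjective' (Ideal.Quotient.mk _) Ideal.Quotient.mk_surjective
  have hCM := cmClause_of_secantColonAnnihilator_eq_top_of_surjective hφ' htop
  -- a system of parameters of `𝒪/(xs)`, weakly regular by the clause; lift it
  obtain ⟨s, hs⟩ := Literature.RingTheory.TightClosure.exists_isSystemOfParameters (R := O ⧸ (ofList xs : Ideal O)) he
  have hrad := (Literature.RingTheory.TightClosure.isSystemOfParameters_iff.mp hs).2
  have hreg' : IsWeaklyRegular (O ⧸ (ofList xs : Ideal O)) (List.ofFn s) := hCM e he s hrad
  choose zl hzl using fun i => Ideal.Quotient.mk_surjective (s i)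
  refine ⟨List.ofFn zl, ?_, ?_, ?_, List.length_ofFn⟩
  · intro z hz
    obtain ⟨i, rfl⟩ := (List.mem_ofFn' zl z).mp hz
    -- `s i ∈ 𝔪_{𝒪/(xs)}` hence `zl i ∈ 𝔪_𝒪`
    have hsi : s i ∈ maximalIdeal (O ⧸ (ofList xs : Ideal O)) := by
      rw [← hs.2]
      exact Ideal.le_radical (Ideal.subset_span ⟨i, rfl⟩)
    by_contra h
    have hunit : IsUnit (zl i) := not_not.mp fun h' => h ((mem_maximalIdeal _).mpr (mem_nonunits_iff.mpr h'))
    exact (mem_maximalIdeal _).mp hsi (hzl i ▸ hunit.map (Ideal.Quotient.mk _))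
  · -- weakly regular over `𝒪/(xs)` ↔ over `𝒪`
    have hmap : (List.ofFn zl).map (algebraMap O (O ⧸ (ofList xs : Ideal O))) = List.ofFn s := by
      rw [List.map_ofFn]
      exact congrArg List.ofFn (funext fun i => hzl i)
    rw [← RingTheory.Sequence.isWeaklyRegular_map_algebraMap_iff (O ⧸ (ofList xs : Ideal O)), hmap]
    exact hreg'
  · -- total drop: `dim 𝒪/(xs, Z) = dim (𝒪/(xs))/(s) = 0`
    refine isSecantSequence_self_of_ringKrullDim (e := 0) ?_ hd ?_ ?_
    · intro x hx
      rcases List.mem_append.mp hx with hx | hx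
      · exact hmemO x hx
      · obtain ⟨i, rfl⟩ := (List.mem_ofFn' zl x).mp hx
        have hsi : s i ∈ maximalIdeal (O ⧸ (ofList xs : Ideal O)) := by
          rw [← hs.2]; exact Ideal.le_radical (Ideal.subset_span ⟨i, rfl⟩)
        by_contra h
        have hunit : IsUnit (zl i) := not_not.mp fun h' => h ((mem_maximalIdeal _).mpr (mem_nonunits_iff.mpr h'))
        exact (mem_maximalIdeal _).mp hsi (hzl i ▸ hunit.map (Ideal.Quotient.mk _))
    · -- `𝒪/(xs ++ Z) ≅ (𝒪/(xs))/(s)`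
      have hJ : (ofList (List.ofFn zl) : Ideal O).map (Ideal.Quotient.mk (ofList xs : Ideal O)) =
          Ideal.span (Set.range s) := by
        rw [show (ofList (List.ofFn zl) : Ideal O) = Ideal.span {x | x ∈ List.ofFn zl} from rfl,
          Ideal.map_span]
        congr 1
        ext y
        simp only [Set.mem_image, Set.mem_setOf_eq, List.mem_ofFn', Set.mem_range]
        constructor
        · rintro ⟨_, ⟨i, rfl⟩, rfl⟩
          exact ⟨i, (hzl i).symm⟩
        · rintro ⟨i, rfl⟩
          exact ⟨zl i, ⟨i, rfl⟩, hzl i⟩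
      have e1 : (O ⧸ (ofList (xs ++ List.ofFn zl) : Ideal O)) ≃+*
          ((O ⧸ (ofList xs : Ideal O)) ⧸ Ideal.span (Set.range s)) :=
        (Ideal.quotEquivOfEq (ofList_append xs (List.ofFn zl))).trans
          ((DoubleQuot.quotQuotEquivQuotSup _ _).symm.trans (Ideal.quotEquivOfEq hJ))
      rw [ringKrullDim_eq_of_ringEquiv e1, ringKrullDim_quotient_eq_zero_of_radical_isMaximal hrad,
        Nat.cast_zero]
    · rw [List.length_append, List.length_ofFn]; omega

/-- **Item 3: off `V(z_d)` the local ring is Cohen–Macaulay.** If a unit of `𝒪` lifts to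
`𝔯_S(𝒪)`, then every system of parameters of `𝒪` is weakly regular (Kawasaki 2000, p. 2539: "for
`p ∈ X ∖ V(z_d)`, `𝒪_{X,p}` is Cohen–Macaulay since the unit `z_d` lies in `𝔞(𝒪_{X,p})`").
[cite: Kawasaki2000, §5 p. 2539 item 3] -/
theorem cmClause_of_unit_mem_secantColonAnnihilator {u : S} (hu : IsUnit (algebraMap S O u))
    (huann : u ∈ secantColonAnnihilator S O) :
    ∀ d : ℕ, ringKrullDim O = d → ∀ s : Fin d → O, (Ideal.span (Set.range s)).radical.IsMaximal →
      IsWeaklyRegular O (List.ofFn s) := by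
  have huS : IsUnit u := by
    by_contra h
    have hm : u ∈ maximalIdeal S := (mem_maximalIdeal u).mpr (mem_nonunits_iff.mpr h)
    have hm' := (mem_maximalIdeal_iff_of_surjective hφ u).mpr hm
    exact (mem_maximalIdeal _).mp hm' hu
  exact cmClause_of_secantColonAnnihilator_eq_top_of_surjective hφ
    (Ideal.eq_top_of_isUnit_mem _ huann huS)

end Local

/-! ## From the global annihilator ideal of a chart to `𝔯_S` of the local module -/

section Bridge

variable {B S : Type u} [CommRing B] [IsNoetherianRing B] [CommRing S] [IsRegularLocalRing S]
  [Algebra B S] (P : Submonoid B) [IsLocalization P S]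
  {M : Type u} [AddCommGroup M] [Module B M] [Module.Finite B M]
  {M' : Type u} [AddCommGroup M'] [Module B M'] [Module S M'] [IsScalarTower B S M']
  [Module.Finite S M'] [Nontrivial M'] (φ : M →ₗ[B] M') (hφ : IsBaseChange S φ)

include P hφ in
/-- **Global-to-local bridge.** Let `B → S` be a localization with `S` regular local of
dimension `n`, `M` a finite `B`-module with base change `M'` to `S` of dimension `d`. If
`z ∈ extAnn B M (n-d, max n 2]` (the `Ext`-annihilator ideal of the chart) then `z/1 ∈ 𝔯_S(M')`
(`extAnn` localizes, `extAnn_map_of_isLocalization`, and THEOREM A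
`prod_annihilator_EMod_le_secantColonAnnihilator`). [cite: Kawasaki2000, La. 2.5 with La. 5.3] -/
theorem mem_secantColonAnnihilator_of_mem_extAnn {n d : ℕ} (hn : ringKrullDim S = n)
    (hd : supportDim S M' = d) {z : B} (hz : z ∈ extAnn B M (Finset.Ioc (n - d) (max n 2))) :
    algebraMap B S z ∈ secantColonAnnihilator S M' := by
  have hT : ∀ q ∈ Finset.Ioc (n - d) (max n 2), 1 ≤ q := fun q hq => by
    have := (Finset.mem_Ioc.mp hq).1; omega
  have h1 : algebraMap B S z ∈ extAnn S M' (Finset.Ioc (n - d) (max n 2)) := by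
    rw [← extAnn_map_of_isLocalization P S φ hφ _ hT]
    exact Ideal.mem_map_of_mem _ hz
  exact prod_annihilator_EMod_le_secantColonAnnihilator (FreeResolution.ofNoetherian (R := S) M') hn hd h1

end Bridge


end Literature.AlgebraicGeometry.Resolution

end
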